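import Literature.MathematicalPhysics.QuantumFieldTheory.Balaban1983to89.B6CubeHolderNormSuppInDecayV1
import Literature.MathematicalPhysics.QuantumFieldTheory.Balaban1983to89.B6HolderPairInputsV1

/-!
# `Balaban1983to89.B6HolderGrad2PairInputsV1` — T. Bałaban, *Propagators and renormalization transformations for lattice gauge theories. II*,
Comm. Math. Phys. **96** (1984) 223–250 [Balaban1984PropagatorsII], Prop. 2.6 (2.139) p. 247 with (2.133) p. 247 and p. 238 (`T_□`): **THE PAIR INPUT
OF A CUBE FOR THE TWO-DIFFERENCE MEMBER ON THE HÖLDER CLASS, FOR AN ADMISSIBLE GLOBAL PAIR** — for a cube `□`, directions `μ, ν` and fine bonds `x, x′`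
of the same direction with `|x − x′|_∞ ≤ L^{j(y(x))}`, `|x − x′|_∞ ≤ L^{j(y(x′))}` near `supp h_□`, the admissible-input pair majorant
`HasMajorantA (y′ ∈ Q^T_□ ∧ NormSupp {y′} (‖·‖_{α+ε} + |·|)) (P_{x,x′}·E_(μ,+)G_□E_(ν,−)) (s(□)⁻¹·C·e^{ρ₁r₀}·L²t^α·e^{−ρ′d_T})`, `t = |x − x′|_∞/L^{j(y(x))}` —
from the chart-frame letter `…B6CubeHolderNormSuppInDecayV1.hHEGE_cube` for close pairs (`|x − x′|_∞ ≤ L^{j₀}`, through p22's window geometry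
`…B6HolderPairWindowV1.pair_window`) and from two single-point letters `…B6CubeNormSuppInDecayV1.hEGE_cube` (p27) for the remaining pairs
(`L^{j₀} < |x − x′|_∞ ≤ L^{j₀+1}`, where `L²t^α ≥ 1`): p22's `…B6HolderPairInputsV1.pairInputs_cube` for the (2.139) member.

HONEST FRAMING (programme rule): statement-level skeleton of published theorems with citation tags; proofs where landed; nothing here
is a claim about the Yang–Mills mass gap.

PRINT: (2.139) p. 247 «‖ζ∇G∇*J‖_α ≤ O(1)(L^jη)^{−α}(‖ζ‖^ξ_α + |ζ|)e^{−δ₃d(y,y′)}(‖J‖^{ξ′}_{α+ε} + |J|)»; (2.133) p. 247 (the member inequalities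
(1.110)–(1.117) of [4] for `G_□`); [4] (1.109) p. 35 (the Hölder quotient over pairs `|x − x′| ≤ 1`).

## WHAT THIS FILE CERTIFIES (kernel-checked, sorry-free, standard axioms; THEOREMS ONLY)

* §1 `hasMajorantA_pairOp_of_points` — a pair majorant from two single-point ones on an admissible-input class (the `HasMajorantA` twin of p22's
  `inMajorant_pairOp_of_points`); `hasMajorant_mul_mulOp_bdd` (a sized right cut-off under an input-localised majorant), `hasMajorantA_pair_mulOp`
  (the product rule `P_{x,x′}·(f·)·T = f(x′)P_{x,x′}T + (f(x) − f(x′))1_xT` on an admissible-input class), `outLoc_pairOp_mul` — the tools of the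
  assembly `…B6HolderGrad2NormSuppLegKLevelV1`;
* §2 **`hHEGE_pair_cube`** — the statement above, with the level comparability `j(y(x′)) ≤ j(y(x)) + 1`, `j(y(x)) ≤ j(y(x′)) + 1` and the block distance
  `d_T(y(x), y(x′)) ≤ r₀` of the pair DISPLAYED (discharged downstream by p22's `…B6HolderPairGeometryV1`), exactly as in `pairInputs_cube`.

HONEST SCOPE: one cube, one admissible pair; constants ours on `d, L, a₀, a₁, α, ε` (`e^{ρ₁r₀}` explicit); V1 torus, census sub-case `supp J ⊂ Δ(y′)`
(GAPS G-B6-2138-SUPP).  NOT summit progress.  Unit `pub-ymgap-dag-n02-b` (Track-A seat, D-0062; slot c4 of node N03), 2026-08-25.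
-/

noncomputable section

open scoped BigOperators
open Finset

namespace Literature.MathematicalPhysics.QuantumFieldTheory.Balaban1983to89.B6HolderGrad2PairInputsV1

open LatticeFieldCalculus
open B6MultiLevelBoxOperator (N0 bigSide)
open B6MultiLevelTorusOperator (TDomains)
open B6Eq238MultiLevelTorus (svec)
open B6Cover236MultiLevelBlocks (cubes)
open B6Geom246MultiLevelBox (bset)
open B6Geom246MultiLevelTorus (geomT)
open B6Partition118KLevelTorusCentral (one_le_of_four_le)
open B6GlobalChartV1 (PV toBox blkV1 domT)
open B6AgreeLapV1Chart (cB eB mem_cB_W)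
open B6Prop26KLevelSkeletonV1 (hB ST mem_ST blkV1_mem_QT_of_hB_ne_zero)
open B6SectAOperatorsV1 (BondIdx)
open B6RandomWalk (HasMajorant BlockSupp)
open B6Prop26Gluing (mulOp mulOp_apply ind ind_nonneg ind_of_mem ind_of_not_mem OutLoc)
open B6InMajorantTransplant (InMajorant)
open B6RandomWalkInputNorm (HasMajorantA NormSupp hasMajorantA_mono)
open B6HolderNormV1 (holderV1 supNormV1)
open B6TranslateTorusV1 (vch)
open B6Eq292MemberTorusV1 (EC)
open B6CubeWindowV1 (x0 j0 tC tC_j hx0 hfit Placed wC Gl sc)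
open B6CubeInDecayV1 (sc_nonneg)
open B6CubeNormSuppInDecayV1 (hEGE_cube)
open B6CubeHolderNormSuppInDecayV1 (hHEGE_cube)
open B6GradLegKLevelV1 (blkV1_mem_ST_of_hB_shift_ne_zero)
open B6HolderPairMemberV1 (pairOp pairOp_apply pairOp_mul_apply)
open B6HolderPairWindowV1 (pair_window mem_W_of_deep_one)
open B6HolderPairInputsV1 (geomT_dist_triangle level_le_j0_succ_of_mem_ST)

/-! ## §1  A pair majorant from two single-point ones, admissible-input class -/

section Tools

variable {X : Type} [DecidableEq X] {g : B6.Geometry}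

/-- **A PAIR MAJORANT FROM TWO SINGLE-POINT ONES ON AN ADMISSIBLE-INPUT CLASS** (`|Tμ(x) − Tμ(x′)| ≤ |Tμ(x)| + |Tμ(x′)|`, the bound at `x′` moved to the
block of `x` at the cost `M`). [cite: Balaban1984PropagatorsII, (2.139) p.247 with [4] (1.109) p.35; bookkeeping ours] -/
theorem hasMajorantA_pairOp_of_points (blk : X → g.Site) {adm : (X → ℝ) → g.Site → ℝ → Prop} (x x' : X) {T : Module.End ℝ (X → ℝ)}
    {K : g.Site → g.Site → ℝ} (hK : ∀ a b, 0 ≤ K a b) (hadm : ∀ (μ : X → ℝ) (y' : g.Site) (B : ℝ), adm μ y' B → 0 ≤ B)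
    (hT : HasMajorantA blk adm T K) {M : ℝ} (hM : 0 ≤ M) (hcmp : ∀ y', K (blk x') y' ≤ M * K (blk x) y') :
    HasMajorantA blk adm (pairOp x x' * T) (fun y y' => (1 + M) * K y y') := by
  intro y' μ B hμ z
  have hB := hadm μ y' B hμ
  rw [pairOp_mul_apply]
  by_cases hz : z = x
  · rw [if_pos hz, hz]
    have h1 := hT y' μ B hμ x
    have h2 := hT y' μ B hμ x'
    calc |T μ x - T μ x'| ≤ |T μ x| + |T μ x'| := abs_sub _ _
      _ ≤ K (blk x) y' * B + M * K (blk x) y' * B := add_le_add h1 (h2.trans (mul_le_mul_of_nonneg_right (hcmp y') hB))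
      _ = (1 + M) * K (blk x) y' * B := by ring
  · rw [if_neg hz, abs_zero]
    exact mul_nonneg (mul_nonneg (by linarith) (hK _ _)) hB

omit [DecidableEq X] in
/-- **A SIZED RIGHT CUT-OFF UNDER AN INPUT-LOCALISED MAJORANT**: `InMajorant T S K`, `supp h ⊂ S` (blocks), `|h| ≤ t` ⟹ `T·(h·)` has the global
majorant `1_S(y′)·t·K` (p22's `hasMajorant_mul_mulOp_of_inMajorant` with the size free). [cite: Balaban1984PropagatorsII, (2.51) p.232, (2.91) p.239; bookkeeping] -/
theorem hasMajorant_mul_mulOp_bdd (blk : X → g.Site) {T : Module.End ℝ (X → ℝ)} {h : X → ℝ} {S : Set g.Site}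
    {K : g.Site → g.Site → ℝ} {t : ℝ} (hK : ∀ a b, 0 ≤ K a b) (ht : 0 ≤ t) (hhsupp : ∀ x, h x ≠ 0 → blk x ∈ S) (hhle : ∀ x, |h x| ≤ t)
    (hT : InMajorant blk T S K) : HasMajorant blk (T * mulOp h) (fun a b => ind S b * (t * K a b)) := by
  intro y' μ B hμ z
  beta_reduce
  rw [Module.End.mul_apply]
  by_cases hy : y' ∈ S
  · rw [ind_of_mem hy, one_mul]
    have hμ' : BlockSupp blk (mulOp h μ) y' (t * B) := by
      refine ⟨mul_nonneg ht hμ.nonneg, fun x hx => ?_, fun x hx => ?_⟩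
      · rw [mulOp_apply, abs_mul]
        exact mul_le_mul (hhle x) (hμ.bound x hx) (abs_nonneg _) ht
      · rw [mulOp_apply, hμ.off x hx, mul_zero]
    calc |T (mulOp h μ) z| ≤ K (blk z) y' * (t * B) := hT y' hy (mulOp h μ) (t * B) hμ' z
      _ = t * K (blk z) y' * B := by ring
  · have h0 : mulOp h μ = 0 := by
      funext x
      rw [mulOp_apply, Pi.zero_apply]
      by_cases hx : blk x = y'
      · have : h x = 0 := by
          by_contra hne; exact hy (hx ▸ hhsupp x hne)
        rw [this, zero_mul]
      · rw [hμ.off x hx, mul_zero]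
    rw [h0, map_zero, Pi.zero_apply, abs_zero]
    exact mul_nonneg (mul_nonneg (ind_nonneg _ _) (mul_nonneg ht (hK _ _))) hμ.nonneg

/-- **THE PRODUCT RULE AT TWO POINTS ON AN ADMISSIBLE-INPUT CLASS**: `P_{x,x′}·(f·)·T = f(x′)·P_{x,x′}T + (f(x) − f(x′))·1_x·T`, so a pair majorant
`K` of `P_{x,x′}·T`, a single-point majorant `K₁` of `T`, `|f| ≤ s_f` and `|f(x) − f(x′)| ≤ σ_f` give `P_{x,x′}·(f·)·T ≺ s_f·K + σ_f·K₁` (read at the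
output `x`; no placement needed). [cite: Balaban1984PropagatorsII, (2.139) p.247 (the factor (‖ζ‖_α + |ζ|)); Balaban1984PropagatorsI, (1.109) p.35; bookkeeping ours] -/
theorem hasMajorantA_pair_mulOp (blk : X → g.Site) {adm : (X → ℝ) → g.Site → ℝ → Prop} (x x' : X) {T : Module.End ℝ (X → ℝ)} {f : X → ℝ}
    {K K₁ : g.Site → g.Site → ℝ} {sf σf : ℝ} (hK : ∀ a b, 0 ≤ K a b) (hK₁ : ∀ a b, 0 ≤ K₁ a b) (hsf : 0 ≤ sf)
    (hadm : ∀ (μ : X → ℝ) (y' : g.Site) (B : ℝ), adm μ y' B → 0 ≤ B)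
    (hpair : HasMajorantA blk adm (pairOp x x' * T) K) (hone : HasMajorantA blk adm T K₁)
    (hle : ∀ z, |f z| ≤ sf) (hLip : |f x - f x'| ≤ σf) :
    HasMajorantA blk adm (pairOp x x' * (mulOp f * T)) (fun a b => sf * K a b + σf * K₁ a b) := by
  intro y' μ B hμ z
  have hB := hadm μ y' B hμ
  have hσ : 0 ≤ σf := (abs_nonneg _).trans hLip
  rw [Module.End.mul_apply, Module.End.mul_apply, pairOp_apply]
  by_cases hz : z = x
  · rw [if_pos hz, hz, mulOp_apply, mulOp_apply]
    have hp : |T μ x - T μ x'| ≤ K (blk x) y' * B := by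
      have := hpair y' μ B hμ x
      rwa [pairOp_mul_apply, if_pos rfl] at this
    have hs : |T μ x| ≤ K₁ (blk x) y' * B := hone y' μ B hμ x
    have e : f x * T μ x - f x' * T μ x' = f x' * (T μ x - T μ x') + (f x - f x') * T μ x := by ring
    rw [e]
    calc |f x' * (T μ x - T μ x') + (f x - f x') * T μ x|
        ≤ |f x'| * |T μ x - T μ x'| + |f x - f x'| * |T μ x| := by
          refine (abs_add_le _ _).trans ?_; rw [abs_mul, abs_mul]
      _ ≤ sf * (K (blk x) y' * B) + σf * (K₁ (blk x) y' * B) :=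
          add_le_add (mul_le_mul (hle x') hp (abs_nonneg _) hsf) (mul_le_mul hLip hs (abs_nonneg _) hσ)
      _ = (sf * K (blk x) y' + σf * K₁ (blk x) y') * B := by ring
  · rw [if_neg hz, abs_zero]
    exact mul_nonneg (add_nonneg (mul_nonneg hsf (hK _ _)) (mul_nonneg hσ (hK₁ _ _))) hB

/-- `P_{x,x′}·W` produces outputs at `x` only, hence over the block `y(x)`. [cite: Balaban1984PropagatorsI, (1.109) p.35; bookkeeping] -/
theorem outLoc_pairOp_mul (blk : X → g.Site) (x x' : X) (W : Module.End ℝ (X → ℝ)) :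
    OutLoc blk (pairOp x x' * W) ({blk x} : Set g.Site) := by
  intro v z hz
  rw [pairOp_mul_apply]
  by_cases hzx : z = x
  · exact absurd (by rw [hzx]; exact Set.mem_singleton _) hz
  · rw [if_neg hzx]

/-- `(Λ²t)^α ≤ Λ²·t^α` for `Λ² ≥ 1`, `α ≤ 1`, `t ≥ 0`. [folklore] -/
private theorem rpow_scale_le {A t α : ℝ} (hA : 1 ≤ A) (ht : 0 ≤ t) (hα1 : α ≤ 1) : (A * t) ^ α ≤ A * t ^ α := by
  rw [Real.mul_rpow (by linarith) ht]
  refine mul_le_mul_of_nonneg_right ?_ (Real.rpow_nonneg ht _)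
  calc A ^ α ≤ A ^ (1 : ℝ) := Real.rpow_le_rpow_of_exponent_le hA hα1
    _ = A := Real.rpow_one A

/-- `1 ≤ A·t^α` once `A⁻¹ ≤ t ≤ 1`, `A ≥ 1`, `α ≤ 1`. [folklore] -/
private theorem one_le_mul_rpow {A t α : ℝ} (hA : 1 ≤ A) (ht : A⁻¹ ≤ t) (ht1 : t ≤ 1) (hα1 : α ≤ 1) : 1 ≤ A * t ^ α := by
  have hA0 : 0 < A := by linarith
  have ht0 : 0 < t := lt_of_lt_of_le (inv_pos.2 hA0) ht
  have h1 : A⁻¹ ≤ t ^ α := ht.trans ((Real.rpow_one t).symm.le.trans (Real.rpow_le_rpow_of_exponent_ge ht0 ht1 hα1))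
  calc (1 : ℝ) = A * A⁻¹ := (mul_inv_cancel₀ hA0.ne').symm
    _ ≤ A * t ^ α := mul_le_mul_of_nonneg_left h1 hA0.le

end Tools

/-! ## §2  The pair input of a cube for the two-difference member on the Hölder class, admissible global pairs -/

section Cube

variable {d ℓ : ℕ} {hd : 1 ≤ d + 1} {hL : Odd (ℓ + 1) ∧ 1 < ℓ + 1} {m K : ℕ} {Mh k R : ℕ} {P' : Fin (d + 1) → ℕ}

/-- `x − 0 = x` for bonds. [folklore] -/
private theorem translate_neg_add (v : Site (PV d ℓ m K hd hL) 0) (x : PBond (PV d ℓ m K hd hL) 0) : (x.translate (-v)).translate v = x := by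
  rw [PBond.translate_translate, neg_add_cancel]; cases x; simp [PBond.translate]

open Classical in
/-- **THE PAIR INPUT OF A CUBE FOR THE TWO-DIFFERENCE MEMBER `E_(μ,+)·G_□·E_(ν,−)` ON THE HÖLDER CLASS, ADMISSIBLE GLOBAL PAIRS** (`L ≥ 5`): there are
`ρ′ > 0`, `ρ₁ ≥ 0` and, for `0 ≤ α`, `0 < ε`, `α + ε < 1`, `C_P ≥ 0` (on `d, L, α, ε` and the weight band) such that on every admissible V1 torus
(`M_h = Lᵃ ≥ 8`, `R ≥ 2L²`, `P′ ≥ 5`, cube placed), for every `c′`, weights, directions `μ, ν`, cube `□`, `r₀ ≥ 0` and fine bonds `x, x′` with: the same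
direction, `|x − x′|_∞ ≤ L^{j(y(x))}`, `|x − x′|_∞ ≤ L^{j(y(x′))}`, `h_□ ≠ 0` at `x`, `x + e_μ`, `x′` or `x′ + e_μ`, `j(y(x′)) ≤ j(y(x)) + 1`,
`j(y(x)) ≤ j(y(x′)) + 1`, `d_T(y(x), y(x′)) ≤ r₀`:
`HasMajorantA (y′ ∈ Q^T_□ ∧ NormSupp {y′} (‖·‖_{α+ε} + |·|)) (P_{x,x′}·E_(μ,+)G_□E_(ν,−)) (s(□)⁻¹·C_P·e^{ρ₁r₀}·L²t^α·e^{−ρ′d_T})`,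
`t = |x − x′|_∞/L^{j(y(x))}` — the member's (1.113) read on the global torus for the pair.
[cite: Balaban1984PropagatorsII, Prop. 2.6 (2.139) p.247, (2.133) p.247, p.238 (T_□); Balaban1984PropagatorsI, (1.109) p.35, (1.113) p.36] -/
theorem hHEGE_pair_cube (d ℓ : ℕ) (hd : 1 ≤ d + 1) (hL : Odd (ℓ + 1) ∧ 1 < ℓ + 1) {a₀ a₁ : ℝ} (ha₀ : 0 < a₀) (ha₁ : a₀ ≤ a₁) :
    ∃ ρ' : ℝ, 0 < ρ' ∧ ∃ ρ₁ : ℝ, 0 ≤ ρ₁ ∧ ∀ α ε : ℝ, 0 ≤ α → 0 < ε → α + ε < 1 → ∃ CP : ℝ, 0 ≤ CP ∧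
      ∀ (m K : ℕ) {Mh k R : ℕ} {P' : Fin (d + 1) → ℕ}
      (hN : ∀ μ, N0 ℓ Mh k P' μ = (PV d ℓ m K hd hL).sitesPerDir 0) (D : TDomains d ℓ Mh k P' R) (hk : k ≤ m + K)
      (hMh1 : 1 ≤ Mh) (hP4 : ∀ μ, 4 ≤ P' μ) {a : ℕ} (hMha : Mh = (ℓ + 1) ^ a) (_ : 8 ≤ Mh) (_ : 2 * (ℓ + 1) ^ 2 ≤ R) (_ : ∀ μ, 5 ≤ P' μ)
      (_ : 4 ≤ ℓ) (c : ↥(cubes D.toDomains)) (hpl : Placed ℓ k P' c.1) (w : BondIdx (domT hN D hk) → ℝ) (cf : ℝ) (μ ν : Fin (d + 1))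
      (r₀ : ℝ) (_ : 0 ≤ r₀) (x x' : PBond (PV d ℓ m K hd hL) 0) (_ : x.dir = x'.dir)
      (_ : supDist x.src x'.src ≤ (ℓ + 1) ^ (blkV1 hN D x).1.1) (_ : supDist x.src x'.src ≤ (ℓ + 1) ^ (blkV1 hN D x').1.1)
      (_ : hB hN D c x ≠ 0 ∨ hB hN D c ⟨x.src.shift μ, x.dir⟩ ≠ 0 ∨ hB hN D c x' ≠ 0 ∨ hB hN D c ⟨x'.src.shift μ, x'.dir⟩ ≠ 0)
      (_ : (blkV1 hN D x').1.1 ≤ (blkV1 hN D x).1.1 + 1) (_ : (blkV1 hN D x).1.1 ≤ (blkV1 hN D x').1.1 + 1)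
      (_ : (geomT D).dist (blkV1 hN D x) (blkV1 hN D x') ≤ r₀),
      HasMajorantA (g := geomT D) (blkV1 hN D)
        (fun J y' B => y' ∈ ST D hMh1 hP4 c ∧ NormSupp (g := geomT D) (blkV1 hN D) (fun y' => ({y'} : Set (geomT D).Site))
          (fun _ J => holderV1 hN D (α + ε) J + supNormV1 J) J y' B)
        (pairOp x x' * (EC hN hk hMh1 hP4 hMha c ha₁ hpl w cf (μ, true) * Gl hN hk hMh1 hP4 hMha c ha₁ hpl w cf *
          EC hN hk hMh1 hP4 hMha c ha₁ hpl w cf (ν, false)))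
        (fun y y' => (sc hMh1 hP4 c cf)⁻¹ * ((CP * Real.exp (ρ₁ * r₀) * ((((ℓ + 1 : ℕ) : ℝ)) ^ 2 *
            ((((supDist x.src x'.src : ℕ) : ℝ) / (((ℓ + 1 : ℕ) : ℝ)) ^ (blkV1 hN D x).1.1) ^ α))) * Real.exp (-(ρ' * (geomT D).dist y y')))) := by
  obtain ⟨ρA, hρA, HA⟩ := hHEGE_cube d ℓ hd hL ha₀ ha₁
  obtain ⟨ρE, hρE, HE1⟩ := hEGE_cube d ℓ hd hL ha₀ ha₁
  refine ⟨min ρA ρE, lt_min hρA hρE, ρE, hρE.le, fun α ε hα0 hε0 hαε => ?_⟩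
  have hα1 : α < 1 := by linarith
  have hε'0 : 0 < α + ε := by linarith
  obtain ⟨CA, hCA, hA⟩ := HA α ε hα0 hε0 hαε
  obtain ⟨CE, hCE, hE⟩ := HE1 (α + ε) hε'0 hαε
  refine ⟨CA + 2 * CE, by positivity, ?_⟩
  intro m K Mh k R P' hN D hk hMh1 hP4 a hMha hM8 hR2 hP5 hℓ c hpl w cf μ ν r₀ hr₀ x x' hdir hs1 hs2 hact hl1 hl2 hdT
  have hMh : 2 ≤ Mh := le_trans (by norm_num) hM8
  have hR : 2 * (ℓ + 1) ≤ R := le_trans (by nlinarith : 2 * (ℓ + 1) ≤ 2 * (ℓ + 1) ^ 2) hR2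
  have hP : ∀ μ, 1 ≤ P' μ := one_le_of_four_le hP4
  have hdnn : ∀ y y' : (geomT D).Site, 0 ≤ (geomT D).dist y y' := fun _ _ => Nat.cast_nonneg _
  have hcls0 : ∀ (J : PBond (PV d ℓ m K hd hL) 0 → ℝ) (y' : (geomT D).Site) (B : ℝ),
      (y' ∈ ST D hMh1 hP4 c ∧ NormSupp (g := geomT D) (blkV1 hN D) (fun y' => ({y'} : Set (geomT D).Site))
        (fun _ J => holderV1 hN D (α + ε) J + supNormV1 J) J y' B) → 0 ≤ B := fun _ _ _ h => h.2.nonneg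
  set Λ : ℝ := ((ℓ + 1 : ℕ) : ℝ) with hΛ
  have hΛ1 : (1 : ℝ) ≤ Λ := by rw [hΛ]; exact_mod_cast Nat.succ_pos ℓ
  have hΛ2 : (1 : ℝ) ≤ Λ ^ 2 := by nlinarith
  set s : ℝ := ((supDist x.src x'.src : ℕ) : ℝ) with hs
  have hs0 : 0 ≤ s := Nat.cast_nonneg _
  set jx : ℕ := (blkV1 hN D x).1.1 with hjx
  set t : ℝ := s / Λ ^ jx with ht
  have hJx : (0 : ℝ) < Λ ^ jx := by positivity
  have ht0 : 0 ≤ t := by positivity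
  have ht1 : t ≤ 1 := by
    rw [ht, div_le_one hJx, hs, hΛ]; exact_mod_cast hs1
  set Er : ℝ := Real.exp (ρE * r₀) with hEr_def
  have hEr1 : 1 ≤ Er := Real.one_le_exp (mul_nonneg hρE.le hr₀)
  have hsc0 : 0 ≤ (sc hMh1 hP4 c cf)⁻¹ := inv_nonneg.2 (sc_nonneg hMh1 hP4 c cf)
  -- the active block is in `□⁺`, its level is `≤ j₀ + 1`; hence `|x − x′|_∞ ≤ L^{j₀+1}` and `j(y(x)) ≤ j₀ + 2`
  have hST : blkV1 hN D x ∈ ST D hMh1 hP4 c ∨ blkV1 hN D x' ∈ ST D hMh1 hP4 c := by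
    rcases hact with h | h | h | h
    · exact Or.inl ((mem_ST D hMh1 hP4 c _).2 (blkV1_mem_QT_of_hB_ne_zero hN D hMh hR hP4 c h))
    · exact Or.inl (blkV1_mem_ST_of_hB_shift_ne_zero hN hMh1 hP4 c hM8 hR hP5 μ h)
    · exact Or.inr ((mem_ST D hMh1 hP4 c _).2 (blkV1_mem_QT_of_hB_ne_zero hN D hMh hR hP4 c h))
    · exact Or.inr (blkV1_mem_ST_of_hB_shift_ne_zero hN hMh1 hP4 c hM8 hR hP5 μ h)
  have hjx2 : jx ≤ j0 hMh1 hP4 c + 2 := by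
    rcases hST with h | h
    · have := level_le_j0_succ_of_mem_ST hMh hR2 hL c h; omega
    · have := level_le_j0_succ_of_mem_ST hMh hR2 hL c h; omega
  have hsD : supDist x.src x'.src ≤ (ℓ + 1) ^ (j0 hMh1 hP4 c + 1) := by
    rcases hST with h | h
    · exact hs1.trans (Nat.pow_le_pow_right (Nat.succ_pos ℓ) (level_le_j0_succ_of_mem_ST hMh hR2 hL c h))
    · exact hs2.trans (Nat.pow_le_pow_right (Nat.succ_pos ℓ) (level_le_j0_succ_of_mem_ST hMh hR2 hL c h))
  -- rates
  have hexp : ∀ {r : ℝ}, min ρA ρE ≤ r → ∀ u : ℝ, 0 ≤ u → Real.exp (-(r * u)) ≤ Real.exp (-(min ρA ρE * u)) :=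
    fun hr u hu => Real.exp_le_exp.mpr (neg_le_neg (mul_le_mul_of_nonneg_right hr hu))
  -- the target size `τ = C_P·Er·L²t^α`
  set τ : ℝ := (CA + 2 * CE) * Er * (Λ ^ 2 * t ^ α) with hτ
  have hLt : 0 ≤ Λ ^ 2 * t ^ α := mul_nonneg (by positivity) (Real.rpow_nonneg ht0 _)
  have hτnn : 0 ≤ τ := by rw [hτ]; positivity
  -- generic final step: from a kernel `s⁻¹·(τ₀·e^{−r d})`, `τ₀ ≤ τ`, `r ≥ ρ′`
  have fin : ∀ {T : Module.End ℝ (PBond (PV d ℓ m K hd hL) 0 → ℝ)} {τ₀ r : ℝ}, τ₀ ≤ τ → min ρA ρE ≤ r →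
      HasMajorantA (g := geomT D) (blkV1 hN D)
        (fun J y' B => y' ∈ ST D hMh1 hP4 c ∧ NormSupp (g := geomT D) (blkV1 hN D) (fun y' => ({y'} : Set (geomT D).Site))
          (fun _ J => holderV1 hN D (α + ε) J + supNormV1 J) J y' B) T
        (fun y y' => (sc hMh1 hP4 c cf)⁻¹ * (τ₀ * Real.exp (-(r * (geomT D).dist y y')))) →
      HasMajorantA (g := geomT D) (blkV1 hN D)
        (fun J y' B => y' ∈ ST D hMh1 hP4 c ∧ NormSupp (g := geomT D) (blkV1 hN D) (fun y' => ({y'} : Set (geomT D).Site))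
          (fun _ J => holderV1 hN D (α + ε) J + supNormV1 J) J y' B) T
        (fun y y' => (sc hMh1 hP4 c cf)⁻¹ * (τ * Real.exp (-(min ρA ρE * (geomT D).dist y y')))) := by
    intro T τ₀ r hτ₀ hr hT
    refine hasMajorantA_mono (g := geomT D) (blkV1 hN D) hT hcls0 fun y y' => ?_
    have := hexp hr _ (hdnn y y')
    exact mul_le_mul_of_nonneg_left (mul_le_mul hτ₀ this (Real.exp_nonneg _) hτnn) hsc0
  by_cases hclose : supDist x.src x'.src ≤ (ℓ + 1) ^ j0 hMh1 hP4 c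
  · -- CLOSE PAIRS: the member's (1.113) through the window
    obtain ⟨hdx, hdx', hsm⟩ := pair_window hN hk hMh1 hP4 hMha c ha₁ hM8 hR2 hpl w cf μ hact hsD
    obtain ⟨hWx, -⟩ := mem_W_of_deep_one hN hk hMh1 hP4 hMha c ha₁ (hpl := hpl) (w := w) (cf := cf)
      (b := x.translate (-vch Mh k (svec ℓ k c.1.1 c.1.2))) hdx μ
    obtain ⟨hWx', -⟩ := mem_W_of_deep_one hN hk hMh1 hP4 hMha c ha₁ (hpl := hpl) (w := w) (cf := cf)
      (b := x'.translate (-vch Mh k (svec ℓ k c.1.1 c.1.2))) hdx' μ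
    have hdir' : (x.translate (-vch Mh k (svec ℓ k c.1.1 c.1.2))).dir = (x'.translate (-vch Mh k (svec ℓ k c.1.1 c.1.2))).dir := by
      simp [PBond.translate_dir, hdir]
    have hsm' := hsm.trans hclose
    rw [← tC_j hN hk hMh1 hP4 c ha₁ a (wC hN hk c w) cf] at hsm'
    have h := hA m K hN D hk hMh1 hP4 hMha hMh hR2 hℓ c hpl w cf μ ν _ _ hWx hWx' hdir' hsm'
    rw [translate_neg_add, translate_neg_add] at h
    -- the member's relative distance: `s_m/L^{j₀} ≤ s/L^{j₀} ≤ L²·t`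
    have hsms : ((supDist (eB (tC hN hk hMh1 hP4 c ha₁ a (wC hN hk c w) cf) (x0 ℓ Mh k c.1) (x.translate (-vch Mh k (svec ℓ k c.1.1 c.1.2)))).src
        (eB (tC hN hk hMh1 hP4 c ha₁ a (wC hN hk c w) cf) (x0 ℓ Mh k c.1) (x'.translate (-vch Mh k (svec ℓ k c.1.1 c.1.2)))).src : ℕ) : ℝ) ≤ s := by
      rw [hs]; exact_mod_cast hsm
    have hsm0 : (0 : ℝ) ≤ ((supDist (eB (tC hN hk hMh1 hP4 c ha₁ a (wC hN hk c w) cf) (x0 ℓ Mh k c.1) (x.translate (-vch Mh k (svec ℓ k c.1.1 c.1.2)))).src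
        (eB (tC hN hk hMh1 hP4 c ha₁ a (wC hN hk c w) cf) (x0 ℓ Mh k c.1) (x'.translate (-vch Mh k (svec ℓ k c.1.1 c.1.2)))).src : ℕ) : ℝ) :=
      Nat.cast_nonneg _
    generalize ((supDist (eB (tC hN hk hMh1 hP4 c ha₁ a (wC hN hk c w) cf) (x0 ℓ Mh k c.1) (x.translate (-vch Mh k (svec ℓ k c.1.1 c.1.2)))).src
        (eB (tC hN hk hMh1 hP4 c ha₁ a (wC hN hk c w) cf) (x0 ℓ Mh k c.1) (x'.translate (-vch Mh k (svec ℓ k c.1.1 c.1.2)))).src : ℕ) : ℝ) = sm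
      at h hsms hsm0
    have hJ : (((ℓ + 1 : ℕ) : ℝ)) ^ (tC hN hk hMh1 hP4 c ha₁ a (wC hN hk c w) cf).j = Λ ^ j0 hMh1 hP4 c := by rw [tC_j]
    rw [hJ] at h
    have hJ0 : (0 : ℝ) < Λ ^ j0 hMh1 hP4 c := by positivity
    have hq : sm / Λ ^ j0 hMh1 hP4 c ≤ Λ ^ 2 * t := by
      have hpow : Λ ^ jx ≤ Λ ^ 2 * Λ ^ j0 hMh1 hP4 c := by rw [← pow_add]; exact pow_le_pow_right₀ hΛ1 (by omega)
      rw [div_le_iff₀ hJ0, ht]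
      calc sm ≤ s := hsms
        _ = s / Λ ^ jx * Λ ^ jx := by field_simp
        _ ≤ s / Λ ^ jx * (Λ ^ 2 * Λ ^ j0 hMh1 hP4 c) := mul_le_mul_of_nonneg_left hpow (by positivity)
        _ = Λ ^ 2 * (s / Λ ^ jx) * Λ ^ j0 hMh1 hP4 c := by ring
    have hsm0' : 0 ≤ sm / Λ ^ j0 hMh1 hP4 c := by positivity
    have hqα : (sm / Λ ^ j0 hMh1 hP4 c) ^ α ≤ Λ ^ 2 * t ^ α :=
      (Real.rpow_le_rpow hsm0' hq hα0).trans (rpow_scale_le hΛ2 ht0 hα1.le)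
    have hCP1 : CA ≤ (CA + 2 * CE) * Er := by
      calc CA ≤ CA + 2 * CE := by linarith
        _ ≤ (CA + 2 * CE) * Er := le_mul_of_one_le_right (by positivity) hEr1
    have hτA : CA * (sm / Λ ^ j0 hMh1 hP4 c) ^ α ≤ τ := by
      rw [hτ]; exact mul_le_mul hCP1 hqα (Real.rpow_nonneg hsm0' _) (by positivity)
    exact fin hτA (min_le_left _ _) h
  · -- REMAINING PAIRS (`L^{j₀} < |x − x′|_∞ ≤ L^{j₀+1}`): two single-point letters and the triangle inequality; here `L²t^α ≥ 1`
    push Not at hclose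
    have hE' := hE m K hN D hk hMh1 hP4 hMha hMh hR2 hℓ c hpl w cf μ ν
    -- `L²·t^α ≥ 1`
    have htlow : (Λ ^ 2)⁻¹ ≤ t := by
      have h1 : Λ ^ j0 hMh1 hP4 c ≤ s := by
        rw [hs, hΛ]; exact_mod_cast (Nat.le_of_lt hclose)
      have hpow : Λ ^ jx ≤ Λ ^ 2 * Λ ^ j0 hMh1 hP4 c := by rw [← pow_add]; exact pow_le_pow_right₀ hΛ1 (by omega)
      rw [ht, le_div_iff₀ hJx, inv_mul_le_iff₀ (by positivity : (0:ℝ) < Λ ^ 2)]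
      exact hpow.trans (mul_le_mul_of_nonneg_left h1 (by positivity))
    have hone : 1 ≤ Λ ^ 2 * t ^ α := one_le_mul_rpow hΛ2 htlow ht1 hα1.le
    -- moving the bound at `y(x′)` to `y(x)`: `e^{−ρd(y(x′),·)} ≤ e^{ρr₀}e^{−ρd(y(x),·)}`
    have hdist : ∀ y' : (geomT D).Site, (geomT D).dist (blkV1 hN D x) y' - r₀ ≤ (geomT D).dist (blkV1 hN D x') y' := by
      intro y'
      have h1 := geomT_dist_triangle hMh1 hP (blkV1 hN D x) (blkV1 hN D x') y'
      linarith only [h1, hdT]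
    have hcmp : ∀ y' : (geomT D).Site,
        (sc hMh1 hP4 c cf)⁻¹ * (CE * Real.exp (-(ρE * (geomT D).dist (blkV1 hN D x') y'))) ≤
          Er * ((sc hMh1 hP4 c cf)⁻¹ * (CE * Real.exp (-(ρE * (geomT D).dist (blkV1 hN D x) y')))) := by
      intro y'
      have h1 : Real.exp (-(ρE * (geomT D).dist (blkV1 hN D x') y')) ≤
          Er * Real.exp (-(ρE * (geomT D).dist (blkV1 hN D x) y')) := by
        rw [hEr_def, ← Real.exp_add]
        refine Real.exp_le_exp.mpr ?_
        have := mul_le_mul_of_nonneg_left (hdist y') hρE.le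
        rw [mul_sub] at this
        linarith only [this]
      calc (sc hMh1 hP4 c cf)⁻¹ * (CE * Real.exp (-(ρE * (geomT D).dist (blkV1 hN D x') y')))
          ≤ (sc hMh1 hP4 c cf)⁻¹ * (CE * (Er * Real.exp (-(ρE * (geomT D).dist (blkV1 hN D x) y')))) :=
            mul_le_mul_of_nonneg_left (mul_le_mul_of_nonneg_left h1 hCE) hsc0
        _ = _ := by ring
    have hK0 : ∀ a b : (geomT D).Site, 0 ≤ (sc hMh1 hP4 c cf)⁻¹ * (CE * Real.exp (-(ρE * (geomT D).dist a b))) := fun a b => by positivity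
    have hP0 := hasMajorantA_pairOp_of_points (g := geomT D) (blkV1 hN D) x x' hK0 hcls0 hE' (zero_le_one.trans hEr1) hcmp
    have hP1 : HasMajorantA (g := geomT D) (blkV1 hN D)
        (fun J y' B => y' ∈ ST D hMh1 hP4 c ∧ NormSupp (g := geomT D) (blkV1 hN D) (fun y' => ({y'} : Set (geomT D).Site))
          (fun _ J => holderV1 hN D (α + ε) J + supNormV1 J) J y' B)
        (pairOp x x' * (EC hN hk hMh1 hP4 hMha c ha₁ hpl w cf (μ, true) * Gl hN hk hMh1 hP4 hMha c ha₁ hpl w cf *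
          EC hN hk hMh1 hP4 hMha c ha₁ hpl w cf (ν, false)))
        (fun y y' => (sc hMh1 hP4 c cf)⁻¹ * (((1 + Er) * CE) * Real.exp (-(ρE * (geomT D).dist y y')))) :=
      hasMajorantA_mono (g := geomT D) (blkV1 hN D) hP0 hcls0 fun y y' => le_of_eq (by ring)
    -- `(1 + Er)·CE ≤ 2·CE·Er ≤ C_P·Er ≤ τ`
    have hkey : (1 + Er) * CE ≤ τ := by
      rw [hτ]
      have h1 : (1 + Er) * CE ≤ ((CA + 2 * CE) * Er) * 1 := by nlinarith [hEr1, hCE, hCA]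
      calc (1 + Er) * CE ≤ ((CA + 2 * CE) * Er) * 1 := h1
        _ ≤ (CA + 2 * CE) * Er * (Λ ^ 2 * t ^ α) := mul_le_mul_of_nonneg_left hone (by positivity)
    exact fin hkey (min_le_right _ _) hP1

end Cube

end Literature.MathematicalPhysics.QuantumFieldTheory.Balaban1983to89.B6HolderGrad2PairInputsV1

end
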